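import Mathlib
import Summits.CriticalPhenomena.CardyFormulaZ2.Theses.CardyWhiteToColoured
import Summits.CriticalPhenomena.CardyFormulaZ2.Theses.CardyUniqueLimit
import Summits.CriticalPhenomena.CardyFormulaZ2.Theorems.CardyWhiteToColouredNoiseDiscretisation
import Summits.CriticalPhenomena.CardyFormulaZ2.Theorems.CardyWhiteToColouredNoiseFlowFromParts
import Summits.CriticalPhenomena.CardyFormulaZ2.Theorems.CardyWhiteToColouredLimitPayoff
import Summits.CriticalPhenomena.CardyFormulaZ2.Theorems.CardyWhiteToColouredEuclideanCovariance
import Summits.CriticalPhenomena.CardyFormulaZ2.Theorems.CardyWhiteToColouredModelExists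

/-!
# Where the crux `DriftBound` sits: it is equivalent to the route target, and it implies the
# existence and similarity invariance of the bond-`ℤ²` crossing limits

Helper file for the crux item `stmt-CriticalPhenomena-4596`
(`Summit.CriticalPhenomena.CardyFormulaZ2.Theses.CardyWhiteToColoured.DriftBound`, route
`CardyWhiteToColoured` of `CardyFormulaZ2`), lead seat of line `registered`/`birth`
(`Cruxes/DriftBound/Lines/birth.lean`). No new statement is claimed here; these are the exact
consequences, inside the tree, of what is already proved on the route, recorded so that the size
of the remaining stubs of the line (`stub_latticeWindow`, `stub_smoothWindow`) is documented by
kernel-checked implications rather than by prose: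

* `driftBound_of_noiseFlowComparison`, `driftBound_iff_noiseFlowComparison` — since the fixed-width
  discretisation theorem `WhiteToColoured.tendsto_smoothedCrossingProb` (`P^latt_{ℓ,δ}(R) → P^cont_ℓ(R)`
  as `δ → 0⁺` for every fixed `ℓ > 0`) and `ModelExists` (a white noise and a Gaussian bump family
  exist) are theorems, the crux `DriftBound` is *equivalent* to the route's conjecture-grade target
  `NoiseFlowComparison` (X_W): the layer-1 split `X_W ⇐ DriftBound ∧ NoiseDiscretisation` puts all
  of the content of X_W into `DriftBound`.
* `similarityInvariantLimit_of_driftBound`, `limitExists_of_driftBound` — consequently `DriftBound`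
  alone already yields the conclusion of `LimitPayoff`: the bond-`ℤ²` crossing probabilities of every
  conformal rectangle converge as `δ → 0⁺`, to a similarity-invariant limit; in particular it implies
  the open crux `CardyUniqueLimit.LimitExists` (stmt-CriticalPhenomena-0747) of the sibling route.

So any proof of the two window stubs of the line proves existence + similarity invariance of the
scaling limit of critical bond percolation crossing probabilities on `ℤ²` (open; Grimmett 1999 §9.7,
Schramm–Smirnov 2011 §1): they are crux-sized, not lemma-sized.
-/

noncomputable section

namespace Summit.CriticalPhenomena.CardyFormulaZ2.Theorems.WhiteToColoured

open Set Filter Topology MeasureTheory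
open Literature.Probability.LatticeModels Literature.Probability.Percolation
open Literature.Probability.RandomPlanarGeometry
open Summit.CriticalPhenomena.CardyFormulaZ2.Theses.CardyWhiteToColoured

/-- **The target gives the crux**: `NoiseFlowComparison → DriftBound`. Take the white noise `μ` and
the bump family `k` of `ModelExists`; for `ε > 0` and the `ℓ₀` of X_W at `ε/2`, for every
`0 < ℓ < ℓ₀` combine the `δ₀` of X_W with the `δ`-threshold of the fixed-width discretisation
`P^latt_{ℓ,δ}(R) → P^cont_ℓ(R)` (`tendsto_smoothedCrossingProb`) through the triangle inequality. -/
theorem driftBound_of_noiseFlowComparison (hX : NoiseFlowComparison) : DriftBound := by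
  obtain ⟨⟨μ, hμG, hμgen⟩, ⟨k, hk⟩⟩ := cardyWhiteToColoured_modelExists_proof
  have hμ : IsWhiteNoise μ := ⟨hμG, hμgen⟩
  intro R ε hε
  obtain ⟨ℓ₀, hℓ₀, H⟩ := hX μ hμG hμgen k hk R (ε / 2) (half_pos hε)
  refine ⟨ℓ₀, hℓ₀, fun ℓ hℓ hℓlt => ?_⟩
  obtain ⟨δ₁, hδ₁, H₁⟩ := H ℓ hℓ hℓlt
  have ht := tendsto_smoothedCrossingProb hμ hk R hℓ
  rw [Metric.tendsto_nhds] at ht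
  have hev := ht (ε / 2) (half_pos hε)
  rw [eventually_nhdsWithin_iff, Metric.eventually_nhds_iff] at hev
  obtain ⟨δ₂, hδ₂, H₂⟩ := hev
  refine ⟨min δ₁ δ₂, lt_min hδ₁ hδ₂, fun δ hδ hδlt => ?_⟩
  have h1 := H₁ δ hδ (lt_of_lt_of_le hδlt (min_le_left _ _))
  have h2 : dist (smoothedCrossingProb ℓ δ R.carrier (R.arc 0) (R.arc 2))
      (continuumCrossingProb μ k ℓ R) < ε / 2 :=
    H₂ (by simpa [Real.dist_eq, abs_of_pos hδ] using lt_of_lt_of_le hδlt (min_le_right _ _)) hδ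
  rw [Real.dist_eq] at h2
  rw [← smoothedCrossingProb_conformalRectangle_eq]
  change |bondDomainCrossingProb R δ - continuumCrossingProb μ k ℓ R| < ε / 2 at h1
  calc |bondDomainCrossingProb R δ - smoothedCrossingProb ℓ δ R.carrier (R.arc 0) (R.arc 2)|
      ≤ |bondDomainCrossingProb R δ - continuumCrossingProb μ k ℓ R|
        + |continuumCrossingProb μ k ℓ R - smoothedCrossingProb ℓ δ R.carrier (R.arc 0) (R.arc 2)| :=
        abs_sub_le _ _ _
    _ < ε / 2 + ε / 2 := by rw [abs_sub_comm (continuumCrossingProb μ k ℓ R)]; exact add_lt_add h1 h2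
    _ = ε := by ring

/-- **The crux is equivalent to the route target X_W**: `DriftBound ↔ NoiseFlowComparison`
(`→`: the proved glue `NoiseFlowFromParts` with the proved `NoiseDiscretisation`; `←`:
`driftBound_of_noiseFlowComparison`). -/
theorem driftBound_iff_noiseFlowComparison : DriftBound ↔ NoiseFlowComparison :=
  ⟨fun hD => noiseFlowFromParts_proof hD noiseDiscretisation_proof,
    driftBound_of_noiseFlowComparison⟩

/-- **`DriftBound` gives similarity-invariant crossing limits for bond-`ℤ²`**: the conclusion of
`LimitPayoff` — every conformal rectangle has a limit `Φ R` of its crossing probabilities as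
`δ → 0⁺`, and `Φ R' = Φ R` whenever carrier and arcs `0`, `2` of `R'` are the images of those of
`R` under a similarity `z ↦ a z + w`, `a ≠ 0` — follows from `DriftBound` alone, through the
proved items `NoiseFlowFromParts`, `NoiseDiscretisation`, `EuclideanCovariance`, `ModelExists`,
`LimitPayoff`. -/
theorem similarityInvariantLimit_of_driftBound (hD : DriftBound) :
    ∃ Φ : ConformalRectangle → ℝ,
      (∀ R : ConformalRectangle,
        Tendsto (bondDomainCrossingProb R) (nhdsWithin 0 (Set.Ioi 0)) (nhds (Φ R))) ∧
      ∀ (R R' : ConformalRectangle) (a w : ℂ), a ≠ 0 →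
        R'.carrier = (fun z : ℂ => a * z + w) '' R.carrier →
        R'.arc 0 = (fun z : ℂ => a * z + w) '' R.arc 0 →
        R'.arc 2 = (fun z : ℂ => a * z + w) '' R.arc 2 → Φ R' = Φ R :=
  CardyWhiteToColoured.limitPayoff_proof (driftBound_iff_noiseFlowComparison.1 hD)
    euclideanCovariance_proof cardyWhiteToColoured_modelExists_proof

/-- **`DriftBound` implies `LimitExists`** (the open crux stmt-CriticalPhenomena-0747 of route
`CardyUniqueLimit`: the bond-`ℤ²` crossing probabilities of every conformal rectangle converge as
the mesh tends to `0`). -/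
theorem limitExists_of_driftBound (hD : DriftBound) :
    Summit.CriticalPhenomena.CardyFormulaZ2.Theses.CardyUniqueLimit.LimitExists := by
  obtain ⟨Φ, hΦ, -⟩ := similarityInvariantLimit_of_driftBound hD
  exact fun R => ⟨Φ R, hΦ R⟩

/-! ### What the crux says: a common crossing scaling limit

`DriftBound` holds iff bond-`ℤ²` crossing probabilities converge as the mesh tends to `0` AND the
crossing probabilities of the continuum white noise smoothed at width `ℓ` converge, as `ℓ → 0⁺`,
to the same limit (for every white noise and every Gaussian bump family). -/

/-- From the target: the continuum family has the bond-`ℤ²` limit as its own `ℓ → 0⁺` limit. -/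
theorem tendsto_continuumCrossingProb_of_noiseFlowComparison (hX : NoiseFlowComparison)
    {Φ : ConformalRectangle → ℝ}
    (hΦ : ∀ R : ConformalRectangle,
      Tendsto (bondDomainCrossingProb R) (nhdsWithin 0 (Set.Ioi 0)) (nhds (Φ R)))
    {μ : Measure (Literature.MathematicalPhysics.QuantumLattice.FieldConfig ℂ)} (hμ : IsWhiteNoise μ)
    {k : ℝ → ℂ → SchwartzMap ℂ ℝ} (hk : IsGaussianBumpFamily k) (R : ConformalRectangle) :
    Tendsto (fun ℓ => continuumCrossingProb μ k ℓ R) (nhdsWithin 0 (Set.Ioi 0)) (nhds (Φ R)) := by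
  rw [Metric.tendsto_nhdsWithin_nhds]
  intro ε hε
  obtain ⟨ℓ₀, hℓ₀, H⟩ := hX μ hμ.1 hμ.2 k hk R (ε / 2) (half_pos hε)
  refine ⟨ℓ₀, hℓ₀, fun {ℓ} hℓ hℓd => ?_⟩
  have hℓ' : 0 < ℓ := hℓ
  have hℓlt : ℓ < ℓ₀ := by simpa [Real.dist_eq, abs_of_pos hℓ'] using hℓd
  obtain ⟨δ₀, hδ₀, H₀⟩ := H ℓ hℓ' hℓlt
  have hP := hΦ R
  rw [Metric.tendsto_nhdsWithin_nhds] at hP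
  obtain ⟨δ₁, hδ₁, H₁⟩ := hP (ε / 2) (half_pos hε)
  set δ := min δ₀ δ₁ / 2 with hδ
  have hδpos : 0 < δ := by positivity
  have hδ0 : δ < δ₀ := by
    have := min_le_left δ₀ δ₁; rw [hδ]; linarith
  have hδ1 : δ < δ₁ := by
    have := min_le_right δ₀ δ₁; rw [hδ]; linarith
  have h1 : |bondDomainCrossingProb R δ - continuumCrossingProb μ k ℓ R| < ε / 2 := H₀ δ hδpos hδ0
  have h2 : dist (bondDomainCrossingProb R δ) (Φ R) < ε / 2 :=
    H₁ (show δ ∈ Set.Ioi (0 : ℝ) from hδpos) (by simpa [Real.dist_eq, abs_of_pos hδpos] using hδ1)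
  rw [Real.dist_eq] at h2 ⊢
  calc |continuumCrossingProb μ k ℓ R - Φ R|
      ≤ |continuumCrossingProb μ k ℓ R - bondDomainCrossingProb R δ| + |bondDomainCrossingProb R δ - Φ R| :=
        abs_sub_le _ _ _
    _ < ε / 2 + ε / 2 := by rw [abs_sub_comm (continuumCrossingProb μ k ℓ R)]; exact add_lt_add h1 h2
    _ = ε := by ring

/-- A common limit of the lattice and continuum crossing probabilities gives the target X_W. -/
theorem noiseFlowComparison_of_commonLimit {Φ : ConformalRectangle → ℝ}
    (hΦ : ∀ R : ConformalRectangle,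
      Tendsto (bondDomainCrossingProb R) (nhdsWithin 0 (Set.Ioi 0)) (nhds (Φ R)))
    (hΨ : ∀ μ : Measure (Literature.MathematicalPhysics.QuantumLattice.FieldConfig ℂ), IsWhiteNoise μ →
      ∀ k : ℝ → ℂ → SchwartzMap ℂ ℝ, IsGaussianBumpFamily k → ∀ R : ConformalRectangle,
        Tendsto (fun ℓ => continuumCrossingProb μ k ℓ R) (nhdsWithin 0 (Set.Ioi 0)) (nhds (Φ R))) :
    NoiseFlowComparison := by
  intro μ hμG hμgen k hk R ε hε
  have hc := hΨ μ ⟨hμG, hμgen⟩ k hk R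
  rw [Metric.tendsto_nhdsWithin_nhds] at hc
  obtain ⟨ℓ₀, hℓ₀, Hc⟩ := hc (ε / 2) (half_pos hε)
  refine ⟨ℓ₀, hℓ₀, fun ℓ hℓ hℓlt => ?_⟩
  have h2 : dist (continuumCrossingProb μ k ℓ R) (Φ R) < ε / 2 :=
    Hc (show ℓ ∈ Set.Ioi (0 : ℝ) from hℓ) (by simpa [Real.dist_eq, abs_of_pos hℓ] using hℓlt)
  have hP := hΦ R
  rw [Metric.tendsto_nhdsWithin_nhds] at hP
  obtain ⟨δ₀, hδ₀, H₀⟩ := hP (ε / 2) (half_pos hε)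
  refine ⟨δ₀, hδ₀, fun δ hδ hδlt => ?_⟩
  have h1 : dist (bondDomainCrossingProb R δ) (Φ R) < ε / 2 :=
    H₀ (show δ ∈ Set.Ioi (0 : ℝ) from hδ) (by simpa [Real.dist_eq, abs_of_pos hδ] using hδlt)
  rw [Real.dist_eq] at h1 h2
  change |bondDomainCrossingProb R δ - continuumCrossingProb μ k ℓ R| < ε
  calc |bondDomainCrossingProb R δ - continuumCrossingProb μ k ℓ R|
      ≤ |bondDomainCrossingProb R δ - Φ R| + |Φ R - continuumCrossingProb μ k ℓ R| := abs_sub_le _ _ _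
    _ < ε / 2 + ε / 2 := by rw [abs_sub_comm (Φ R)]; exact add_lt_add h1 h2
    _ = ε := by ring

/-- **What the crux `DriftBound` says**: it holds iff there is ONE function `Φ` of conformal
rectangles such that (i) the bond-`ℤ²` crossing probabilities `P_δ(R) → Φ R` as `δ → 0⁺`
(`CardyUniqueLimit.LimitExists` with a named limit) and (ii) for every white noise `μ` on `ℂ` and
every Gaussian bump family `k`, the continuum crossing probabilities `P^cont_ℓ(R) → Φ R` as the
smoothing width `ℓ → 0⁺` — i.e. critical bond percolation on `ℤ²` and the positive set of
Gaussian-smoothed planar white noise have crossing scaling limits, and they coincide. (By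
`similarityInvariantLimit_of_driftBound` the common `Φ` is then similarity invariant.) -/
theorem driftBound_iff_commonLimit :
    DriftBound ↔ ∃ Φ : ConformalRectangle → ℝ,
      (∀ R : ConformalRectangle,
        Tendsto (bondDomainCrossingProb R) (nhdsWithin 0 (Set.Ioi 0)) (nhds (Φ R))) ∧
      ∀ μ : Measure (Literature.MathematicalPhysics.QuantumLattice.FieldConfig ℂ), IsWhiteNoise μ →
        ∀ k : ℝ → ℂ → SchwartzMap ℂ ℝ, IsGaussianBumpFamily k → ∀ R : ConformalRectangle,
          Tendsto (fun ℓ => continuumCrossingProb μ k ℓ R) (nhdsWithin 0 (Set.Ioi 0)) (nhds (Φ R)) := by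
  constructor
  · intro hD
    obtain ⟨Φ, hΦ, -⟩ := similarityInvariantLimit_of_driftBound hD
    exact ⟨Φ, hΦ, fun μ hμ k hk R =>
      tendsto_continuumCrossingProb_of_noiseFlowComparison (driftBound_iff_noiseFlowComparison.1 hD)
        hΦ hμ hk R⟩
  · rintro ⟨Φ, hΦ, hΨ⟩
    exact driftBound_of_noiseFlowComparison (noiseFlowComparison_of_commonLimit hΦ hΨ)

end Summit.CriticalPhenomena.CardyFormulaZ2.Theorems.WhiteToColoured

end
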